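import Literature.NumberTheory.Sieve.FriedlanderIwaniecPrimesJacobiTwistedLemmas
import HarnessLib

/-!
# Friedlander–Iwaniec, *The polynomial `X² + Y⁴` captures its primes*, §11: Lemma 11.4

Family `parity`, statement parity.S17 (`setOf_prime_sq_add_pow_four_infinite`). Source: J. Friedlander,
H. Iwaniec, Ann. of Math. (2) 148 (1998), 945–1040 [FriedlanderIwaniecAnnals1998], §11 "Jacobi-twisted
sums over arithmetic progressions", p. 989, Lemma 11.4 (11.17):

  `∑_{d₁, d₂ ≤ D, d₁'d₂' ≠ □} [d₁, d₂]⁻¹ |∑_{r ≤ R, (r, d₁d₂) = 1} (r / d₁'d₂')|² ≪ R^{3/2} (DR)^ε`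

(`d'` the odd part of `d`, `(· / ·)` the Jacobi symbol), the estimate which controls the non-square
moduli `W^◇` (11.21)–(11.22) in the proof of Proposition 11.1. This is the second file of the
§§11–14 unit ("Jacobi-twisted sums", an "independent unit" of the source feeding Proposition 4.1 =
`FriedlanderIwaniec1998_prop41` through Propositions 14.1 and 15.1); the first,
`FriedlanderIwaniecPrimesJacobiTwistedLemmas`, proves Lemmas 11.2–11.3. Everything here is PROVED;
no definitions, no named facts.

* `sum_sq_coprime_jacobiSym_div_lcm_le` — **Lemma 11.4** as displayed, for every `ε > 0` with a
  constant `C(ε)`, for all `D, R`. Proof as printed: with `e = (d₁, d₂)`, `dᵢ = e bᵢ` one has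
  `[d₁, d₂] = e b₁ b₂`, `(d₁d₂)' = e'² (b₁b₂)'`, and the summand becomes
  `|∑_{r ≤ R, (r, ẽ) = 1} (r / (b₁b₂)')|² / (e b₁ b₂)` with `ẽ = e` or `2e` according as `b₁b₂` is odd or
  even ("The condition `(r, d₁d₂) = 1` is redundant unless `d₁d₂` is even in which case it simply means
  that `r` is odd"; `ite_coprime_jacobiSym_sq_mul`); by positivity the sum extends to all
  `b₁, b₂ ≤ D`, and collecting the pairs by `q = b₁b₂ ≤ D²` (multiplicity `≤ τ(q) ≪ q^ε`,
  `sum_pairs_le_sum_sigma_zero_mul`, the divisor bound `exists_sigma_zero_le_mul_rpow` of the tree)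
  and summing `|…|²/q` over dyadic blocks with Lemma 11.3 (`sum_div_le_sum_dyadic`,
  `sum_pairs_weighted_sq_le`) a block around `Q` costs `≪ min{τ(ẽ)² Q, R + R³/Q} ≤ 2τ(ẽ)² R^{3/2}`
  ("the worst `Q` being `R^{3/2}`", `min_linear_hyperbolic_le`); finally `∑_{e ≤ D} τ(e)²/e` and all
  powers of `log D`, `log R` are absorbed into `(DR)^ε` (`exists_one_add_log_pow_le_rpow`).
* Tools: `exists_one_add_log_pow_le_rpow` (`(1 + log x)^κ ≤ C x^ε`), `ordCompl_two_mul`,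
  `dvd_ordCompl_two_of_odd_prime`, `not_isSquare_ordCompl_of_sq_mul`, `gcd_decomposition`,
  `sum_pairs_le_sum_sigma_zero_mul`, `sum_div_le_sum_dyadic`, `min_linear_hyperbolic_le`.

## References

* J. Friedlander, H. Iwaniec, Ann. of Math. (2) 148 (1998), 945–1040, §11, Lemma 11.4, (11.17).
  [FriedlanderIwaniecAnnals1998]

## Tree / Mathlib

Tree: `sum_sq_coprime_jacobiSym_le_min` (Lemma 11.3), `natLog_two_add_one_le`
(`FriedlanderIwaniecPrimesJacobiTwistedLemmas`); `exists_sigma_zero_le_mul_rpow` (`DivisorBound`);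
`exists_sum_tau_pow_div_le_one` (`FriedlanderIwaniecPrimesGcdSums`); `sigma_zero_mul_le`,
`one_le_sigma_zero` (`DivisorPowerSums`). Mathlib: `Real.log_le_rpow_div`, `Nat.ordCompl_mul`,
`Nat.gcd_mul_lcm`, `Finset.sum_fiberwise_of_maps_to`, `Nat.pow_log_le_self`,
`Nat.lt_pow_succ_log_self`, `Finset.sum_sigma`, `Finset.sum_image`.
-/

noncomputable section

open Finset Real
open scoped NumberTheorySymbols ArithmeticFunction.sigma Nat

namespace Literature.NumberTheory.Sieve.FriedlanderIwaniecPrimes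


/-! ### Absorbing powers of logarithms into `x^ε` -/

/-- `(1 + log x)^κ ≤ C(κ, ε) x^ε` for `x ≥ 1`. [folklore] -/
theorem exists_one_add_log_pow_le_rpow (κ : ℕ) {ε : ℝ} (hε : 0 < ε) :
    ∃ C : ℝ, 0 < C ∧ ∀ x : ℝ, 1 ≤ x → (1 + Real.log x) ^ κ ≤ C * x ^ ε := by
  set δ : ℝ := ε / (κ + 1) with hδ
  have hδ0 : 0 < δ := by positivity
  refine ⟨(1 + δ⁻¹) ^ κ, by positivity, fun x hx => ?_⟩
  have hx0 : 0 ≤ x := by linarith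
  have h1 : Real.log x ≤ x ^ δ / δ := Real.log_le_rpow_div hx0 hδ0
  have h2 : 1 ≤ x ^ δ := Real.one_le_rpow hx hδ0.le
  have h3 : 1 + Real.log x ≤ (1 + δ⁻¹) * x ^ δ := by
    rw [add_mul, one_mul, ← div_eq_inv_mul]; linarith
  have h4 : 0 ≤ 1 + Real.log x := by linarith [Real.log_nonneg hx]
  calc (1 + Real.log x) ^ κ ≤ ((1 + δ⁻¹) * x ^ δ) ^ κ := pow_le_pow_left₀ h4 h3 κ
    _ = (1 + δ⁻¹) ^ κ * x ^ (δ * κ) := by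
        rw [mul_pow, ← Real.rpow_natCast (x ^ δ), ← Real.rpow_mul hx0]
    _ ≤ (1 + δ⁻¹) ^ κ * x ^ ε := by
        refine mul_le_mul_of_nonneg_left (Real.rpow_le_rpow_of_exponent_le hx ?_) (by positivity)
        rw [hδ, div_mul_eq_mul_div, div_le_iff₀ (by positivity)]
        nlinarith

/-! ### Pulling out the greatest common divisor: the summand of Lemma 11.4 -/

/-- The odd part is multiplicative. [folklore] -/
theorem ordCompl_two_mul (a b : ℕ) : ordCompl[2] (a * b) = ordCompl[2] a * ordCompl[2] b :=
  Nat.ordCompl_mul a b 2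

/-- An odd prime dividing `m` divides its odd part. [folklore] -/
theorem dvd_ordCompl_two_of_odd_prime {p m : ℕ} (hp : p.Prime) (hp2 : p ≠ 2) (hpm : p ∣ m) : p ∣ ordCompl[2] m := by
  have h := Nat.ordProj_mul_ordCompl_eq_self m 2
  rw [← h] at hpm
  rcases (Nat.Prime.dvd_mul hp).mp hpm with h1 | h1
  · exact absurd (Nat.prime_dvd_prime_iff_eq hp Nat.prime_two |>.mp (hp.dvd_of_dvd_pow h1)) hp2
  · exact h1

/-- **The summand of Lemma 11.4 after pulling out `e`.** With `n = e² m` (`e, m ≥ 1`):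
`[(r, n) = 1] (r / n') = [(r, ẽ) = 1] (r / m')`, where `ẽ = 2e` if `m` is even and `ẽ = e` if `m` is
odd ("The condition `(r, d₁d₂) = 1` is redundant unless `d₁d₂` is even in which case it simply means
that `r` is odd"; `n' = e'² m'` and `(r / e'²) = [(r, e') = 1]`).
[cite: FriedlanderIwaniecAnnals1998, Lemma 11.4, proof] -/
theorem ite_coprime_jacobiSym_sq_mul {e m : ℕ} (he : 0 < e) (hm : 0 < m) (r : ℕ) :
    (if r.Coprime (e ^ 2 * m) then J((r : ℤ) | ordCompl[2] (e ^ 2 * m)) else 0) =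
      if r.Coprime (if Even m then 2 * e else e) then J((r : ℤ) | ordCompl[2] m) else 0 := by
  set e' := ordCompl[2] e with he'
  set m' := ordCompl[2] m with hm'
  have he'0 : 0 < e' := Nat.ordCompl_pos 2 he.ne'
  have hm'0 : 0 < m' := Nat.ordCompl_pos 2 hm.ne'
  haveI : NeZero m' := ⟨hm'0.ne'⟩
  have hn' : ordCompl[2] (e ^ 2 * m) = e' ^ 2 * m' := by
    rw [ordCompl_two_mul, sq, ordCompl_two_mul, sq]
  have hJ : J((r : ℤ) | ordCompl[2] (e ^ 2 * m)) = J((r : ℤ) | e') ^ 2 * J((r : ℤ) | m') := by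
    rw [hn', jacobiSym.mul_right' _ (pow_ne_zero _ he'0.ne') hm'0.ne', jacobiSym.pow_right]
  have he'e : e' ∣ e := Nat.ordCompl_dvd e 2
  by_cases hcop : r.Coprime (e ^ 2 * m)
  · -- `r` is coprime to `e`, `m`, hence to `e'` and to `ẽ`
    rw [if_pos hcop]
    have hre : r.Coprime e := (Nat.Coprime.coprime_dvd_right (Dvd.intro _ rfl) hcop).coprime_dvd_right
      (dvd_pow_self e two_ne_zero)
    have hre' : r.Coprime e' := hre.coprime_dvd_right he'e
    have hsq : J((r : ℤ) | e') ^ 2 = 1 :=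
      jacobiSym.sq_one (by rw [Int.gcd_natCast_natCast]; exact hre')
    have hrt : r.Coprime (if Even m then 2 * e else e) := by
      split_ifs with hme
      · refine Nat.Coprime.mul_right ?_ hre
        have h2 : 2 ∣ e ^ 2 * m := (even_iff_two_dvd.mp hme).mul_left _
        exact (Nat.Coprime.coprime_dvd_right h2 hcop)
      · exact hre
    rw [if_pos hrt, hJ, hsq, one_mul]
  · rw [if_neg hcop]
    by_cases hrt : r.Coprime (if Even m then 2 * e else e)
    · -- a prime `p ∣ (r, m)` is odd (else `r` would be even and `ẽ = 2e`), so divides `m'`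
      rw [if_pos hrt]
      symm
      rw [jacobiSym.eq_zero_iff_not_coprime, Int.gcd_natCast_natCast]
      intro hrm'
      apply hcop
      have hre : r.Coprime e := by
        by_cases hme : Even m
        · rw [if_pos hme] at hrt; exact hrt.coprime_dvd_right (dvd_mul_left e 2)
        · rw [if_neg hme] at hrt; exact hrt
      refine Nat.Coprime.mul_right (hre.pow_right 2) ?_
      rw [Nat.coprime_iff_gcd_eq_one]
      by_contra hg
      obtain ⟨p, hp, hpg⟩ := Nat.exists_prime_and_dvd hg
      have hpr : p ∣ r := hpg.trans (Nat.gcd_dvd_left r m)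
      have hpm : p ∣ m := hpg.trans (Nat.gcd_dvd_right r m)
      have hp2 : p ≠ 2 := by
        rintro rfl
        have hme : Even m := even_iff_two_dvd.mpr hpm
        rw [if_pos hme] at hrt
        have h2 : 2 ∣ Nat.gcd r (2 * e) := Nat.dvd_gcd hpr (dvd_mul_right 2 e)
        rw [Nat.Coprime.gcd_eq_one hrt] at h2
        omega
      have hpm' : p ∣ m' := dvd_ordCompl_two_of_odd_prime hp hp2 hpm
      have : p ∣ Nat.gcd r m' := Nat.dvd_gcd hpr hpm'
      rw [hrm'] at this
      exact hp.one_lt.ne' (Nat.dvd_one.mp this)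
    · rw [if_neg hrt]

/-- A non-square odd part survives division by `e²`: `¬□ (e² m)' → ¬□ m'`. [folklore] -/
theorem not_isSquare_ordCompl_of_sq_mul {e m : ℕ} (h : ¬IsSquare (ordCompl[2] (e ^ 2 * m))) :
    ¬IsSquare (ordCompl[2] m) := by
  rintro ⟨c, hc⟩
  apply h
  refine ⟨ordCompl[2] e * c, ?_⟩
  rw [ordCompl_two_mul, sq, ordCompl_two_mul, hc]; ring

/-! ### From pairs `(b₁, b₂)` to the product `q = b₁ b₂` -/

/-- **Collecting pairs by their product.** For `F ≥ 0`:
`∑_{b₁, b₂ ≤ D} F(b₁ b₂) ≤ ∑_{q ≤ D²} τ(q) F(q)` (the pair is `(b₁, q/b₁)` with `b₁ ∣ q`). [folklore] -/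
theorem sum_pairs_le_sum_sigma_zero_mul (D : ℕ) {F : ℕ → ℝ} (hF : ∀ q, 0 ≤ F q) :
    ∑ p ∈ (Icc 1 D) ×ˢ (Icc 1 D), F (p.1 * p.2) ≤ ∑ q ∈ Icc 1 (D * D), (σ 0 q : ℝ) * F q := by
  have hinj : Set.InjOn (fun p : ℕ × ℕ => (⟨p.1 * p.2, p.1⟩ : Σ _ : ℕ, ℕ)) ↑((Icc 1 D) ×ˢ (Icc 1 D)) := by
    intro p hp p' hp' h
    simp only [Sigma.mk.inj_iff, heq_eq_eq] at h
    obtain ⟨hprod, h1⟩ := h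
    rw [mem_coe, mem_product, mem_Icc] at hp'
    rw [h1] at hprod
    exact Prod.ext h1 (Nat.eq_of_mul_eq_mul_left hp'.1.1 hprod)
  calc ∑ p ∈ (Icc 1 D) ×ˢ (Icc 1 D), F (p.1 * p.2)
      = ∑ x ∈ ((Icc 1 D) ×ˢ (Icc 1 D)).image (fun p : ℕ × ℕ => (⟨p.1 * p.2, p.1⟩ : Σ _ : ℕ, ℕ)),
          F x.1 := by rw [sum_image hinj]
    _ ≤ ∑ x ∈ (Icc 1 (D * D)).sigma (fun q => q.divisors), F x.1 := by
        refine sum_le_sum_of_subset_of_nonneg ?_ fun _ _ _ => hF _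
        intro x hx
        rw [mem_image] at hx
        obtain ⟨p, hp, rfl⟩ := hx
        rw [mem_product, mem_Icc, mem_Icc] at hp
        rw [mem_sigma, mem_Icc, Nat.mem_divisors]
        refine ⟨⟨Nat.mul_pos hp.1.1 hp.2.1, Nat.mul_le_mul hp.1.2 hp.2.2⟩, Dvd.intro _ rfl,
          (Nat.mul_pos hp.1.1 hp.2.1).ne'⟩
    _ = ∑ q ∈ Icc 1 (D * D), (σ 0 q : ℝ) * F q := by
        rw [sum_sigma]
        refine sum_congr rfl fun q _ => ?_
        simp only [sum_const, nsmul_eq_mul, ArithmeticFunction.sigma_zero_apply]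

/-! ### Dyadic summation of `h(q)/q` -/

/-- **Dyadic blocks.** If `h ≥ 0` and `∑_{q ≤ Q} h(q) ≤ B(Q)` for all `Q`, then
`∑_{q ≤ N} h(q)/q ≤ ∑_{k ≤ log₂ N} B(2^{k+1})/2^k` (group `q` by `k = ⌊log₂ q⌋`, where `q ≥ 2^k` and
`q < 2^{k+1}`). [folklore] -/
theorem sum_div_le_sum_dyadic {h : ℕ → ℝ} (hh : ∀ q, 0 ≤ h q) {B : ℕ → ℝ}
    (hB : ∀ Q, ∑ q ∈ Icc 1 Q, h q ≤ B Q) (N : ℕ) :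
    ∑ q ∈ Icc 1 N, h q / q ≤ ∑ k ∈ range (Nat.log 2 N + 1), B (2 ^ (k + 1)) / 2 ^ k := by
  rw [← sum_fiberwise_of_maps_to (s := Icc 1 N) (t := range (Nat.log 2 N + 1)) (g := Nat.log 2)
    (fun q hq => mem_range.mpr (Nat.lt_succ_of_le (Nat.log_mono_right (mem_Icc.mp hq).2)))]
  refine sum_le_sum fun k _ => ?_
  have h2k : (0 : ℝ) < 2 ^ k := by positivity
  calc ∑ q ∈ (Icc 1 N).filter (fun q => Nat.log 2 q = k), h q / q
      ≤ ∑ q ∈ (Icc 1 N).filter (fun q => Nat.log 2 q = k), h q / 2 ^ k := by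
        refine sum_le_sum fun q hq => ?_
        rw [mem_filter, mem_Icc] at hq
        have hq0 : q ≠ 0 := by omega
        have hle : (2 : ℝ) ^ k ≤ q := by
          rw [← hq.2]; exact_mod_cast Nat.pow_log_le_self 2 hq0
        exact div_le_div_of_nonneg_left (hh q) h2k hle
    _ = (∑ q ∈ (Icc 1 N).filter (fun q => Nat.log 2 q = k), h q) / 2 ^ k := by rw [sum_div]
    _ ≤ (∑ q ∈ Icc 1 (2 ^ (k + 1)), h q) / 2 ^ k := by
        refine div_le_div_of_nonneg_right (sum_le_sum_of_subset_of_nonneg ?_ fun _ _ _ => hh _) h2k.le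
        intro q hq
        rw [mem_filter, mem_Icc] at hq
        rw [mem_Icc]
        refine ⟨hq.1.1, ?_⟩
        have := Nat.lt_pow_succ_log_self one_lt_two q
        rw [hq.2] at this
        exact this.le
    _ ≤ B (2 ^ (k + 1)) / 2 ^ k := div_le_div_of_nonneg_right (hB _) h2k.le


/-! ### The dyadic optimisation "the worst `Q` being `R^{3/2}`" -/

/-- `min{a Q, R + R³/Q} ≤ 2 a R √R` for `a ≥ 1`, `Q > 0`, `R ≥ 1`. [folklore] -/
theorem min_linear_hyperbolic_le {a Q R : ℝ} (ha : 1 ≤ a) (hQ : 0 < Q) (hR : 1 ≤ R) :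
    min (a * Q) (R + R ^ 3 / Q) ≤ 2 * a * (R * Real.sqrt R) := by
  have hR0 : 0 < R := by linarith
  have hs1 : 1 ≤ Real.sqrt R := by rw [← Real.sqrt_one]; exact Real.sqrt_le_sqrt hR
  have hss : Real.sqrt R * Real.sqrt R = R := Real.mul_self_sqrt hR0.le
  have hRR : R ≤ R * Real.sqrt R := by nlinarith
  have hT0 : 0 < R * Real.sqrt R := by positivity
  rcases le_or_gt Q (R * Real.sqrt R) with h | h
  · calc min (a * Q) (R + R ^ 3 / Q) ≤ a * Q := min_le_left _ _
      _ ≤ a * (R * Real.sqrt R) := mul_le_mul_of_nonneg_left h (by linarith)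
      _ ≤ 2 * a * (R * Real.sqrt R) := by nlinarith
  · have h3 : R ^ 3 / Q ≤ R * Real.sqrt R := by
      rw [div_le_iff₀ hQ]
      calc R ^ 3 = (R * Real.sqrt R) * (R * Real.sqrt R) := by
            rw [show R ^ 3 = R * R * R by ring]; nlinarith [hss]
        _ ≤ (R * Real.sqrt R) * Q := mul_le_mul_of_nonneg_left h.le hT0.le
    calc min (a * Q) (R + R ^ 3 / Q) ≤ R + R ^ 3 / Q := min_le_right _ _
      _ ≤ 2 * (R * Real.sqrt R) := by linarith
      _ ≤ 2 * a * (R * Real.sqrt R) := by nlinarith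

/-- **The weighted form of Lemma 11.3** (the heart of Lemma 11.4): for `f ≥ 1`, `D, R ≥ 1`, `ε > 0`,
`∑_{b₁, b₂ ≤ D, (b₁b₂)' ≠ □} |∑_{r ≤ R, (r,f)=1} (r / (b₁b₂)')|² / (b₁ b₂)
  ≤ C τ(f)² R^{3/2} D^ε (1 + log D)^κ (1 + log R)^κ`
(collect the pairs by `q = b₁ b₂ ≤ D²` with multiplicity `≤ τ(q) ≤ C_ε q^{ε/2}`, sum `|…|²/q` over dyadic
blocks with Lemma 11.3: a block around `Q` costs `≪ min{τ(f)² Q, R + R³/Q} ≤ 2 τ(f)² R^{3/2}`, "the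
worst `Q` being `R^{3/2}`"). [cite: FriedlanderIwaniecAnnals1998, Lemma 11.4, proof] -/
theorem sum_pairs_weighted_sq_le {ε : ℝ} (hε : 0 < ε) :
    ∃ C : ℝ, 0 < C ∧ ∃ κ : ℕ, ∀ f D R : ℕ, 0 < f → 1 ≤ D → 1 ≤ R →
      ∑ p ∈ (Icc 1 D) ×ˢ (Icc 1 D),
        (if ¬IsSquare (ordCompl[2] (p.1 * p.2)) then
          ((∑ r ∈ (Icc 1 R).filter (fun r => r.Coprime f), J(r | ordCompl[2] (p.1 * p.2)) : ℤ) : ℝ) ^ 2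
         else 0) / ((p.1 * p.2 : ℕ) : ℝ) ≤
      C * (σ 0 f : ℝ) ^ 2 * ((R : ℝ) * Real.sqrt R) * (D : ℝ) ^ ε *
        (1 + Real.log D) ^ κ * (1 + Real.log R) ^ κ := by
  obtain ⟨C, hC, κ, h113⟩ := sum_sq_coprime_jacobiSym_le_min
  obtain ⟨Cd, hCd1, hCd⟩ := exists_sigma_zero_le_mul_rpow (half_pos hε)
  refine ⟨16 * 2 ^ κ * C * Cd, by positivity, κ + 1, fun f D R hf hD hR => ?_⟩
  have hD1 : (1 : ℝ) ≤ D := by exact_mod_cast hD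
  have hR1 : (1 : ℝ) ≤ R := by exact_mod_cast hR
  have hD0 : (0 : ℝ) < D := by linarith
  have hlogD : 0 ≤ Real.log D := Real.log_nonneg hD1
  have hlogR : 0 ≤ Real.log R := Real.log_nonneg hR1
  have hσf : (1 : ℝ) ≤ σ 0 f := by exact_mod_cast one_le_sigma_zero hf.ne'
  -- the functions
  set S : ℕ → ℝ := fun n =>
    ((∑ r ∈ (Icc 1 R).filter (fun r => r.Coprime f), J(r | n) : ℤ) : ℝ) with hS
  set h : ℕ → ℝ := fun q => if ¬IsSquare (ordCompl[2] q) then S (ordCompl[2] q) ^ 2 else 0 with hh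
  have hh0 : ∀ q, 0 ≤ h q := fun q => by simp only [hh]; split_ifs <;> positivity
  set B : ℕ → ℝ := fun Q => C * min ((σ 0 f : ℝ) ^ 2 * (Q : ℝ) ^ 2) ((Q : ℝ) * R + (R : ℝ) ^ 3) *
    ((1 + Real.log Q) * (1 + Real.log R)) ^ κ with hB
  have hBQ : ∀ Q, ∑ q ∈ Icc 1 Q, h q ≤ B Q := by
    intro Q
    have := h113 f Q R hf
    simp only [hh, hB]
    rw [← sum_filter]
    exact this
  -- step 1: pairs → `q` with multiplicity `τ(q) ≤ Cd D^ε`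
  have hDε : ∀ q ∈ Icc 1 (D * D), (σ 0 q : ℝ) ≤ Cd * (D : ℝ) ^ ε := by
    intro q hq
    rw [mem_Icc] at hq
    refine (hCd q).trans (mul_le_mul_of_nonneg_left ?_ (by linarith))
    calc (q : ℝ) ^ (ε / 2) ≤ ((D : ℝ) * D) ^ (ε / 2) :=
          Real.rpow_le_rpow (Nat.cast_nonneg q) (by exact_mod_cast hq.2) (by linarith)
      _ = (D : ℝ) ^ ε := by
          rw [show (D : ℝ) * D = (D : ℝ) ^ (2 : ℝ) by rw [Real.rpow_two, sq], ← Real.rpow_mul hD0.le]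
          congr 1; ring
  have step1 : ∑ p ∈ (Icc 1 D) ×ˢ (Icc 1 D), h (p.1 * p.2) / ((p.1 * p.2 : ℕ) : ℝ) ≤
      Cd * (D : ℝ) ^ ε * ∑ q ∈ Icc 1 (D * D), h q / q := by
    calc ∑ p ∈ (Icc 1 D) ×ˢ (Icc 1 D), h (p.1 * p.2) / ((p.1 * p.2 : ℕ) : ℝ)
        ≤ ∑ q ∈ Icc 1 (D * D), (σ 0 q : ℝ) * (h q / q) :=
          sum_pairs_le_sum_sigma_zero_mul D (F := fun q => h q / q) fun q => by
            have := hh0 q; positivity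
      _ ≤ ∑ q ∈ Icc 1 (D * D), Cd * (D : ℝ) ^ ε * (h q / q) := by
          refine sum_le_sum fun q hq => mul_le_mul_of_nonneg_right (hDε q hq) ?_
          have := hh0 q; positivity
      _ = Cd * (D : ℝ) ^ ε * ∑ q ∈ Icc 1 (D * D), h q / q := by rw [← mul_sum]
  -- step 2: dyadic blocks
  have hblock : ∀ k ∈ range (Nat.log 2 (D * D) + 1),
      B (2 ^ (k + 1)) / 2 ^ k ≤ 4 * C * (σ 0 f : ℝ) ^ 2 * ((R : ℝ) * Real.sqrt R) *
        ((2 * (1 + Real.log D)) * (1 + Real.log R)) ^ κ := by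
    intro k hk
    rw [mem_range] at hk
    have hk' : k ≤ Nat.log 2 (D * D) := by omega
    set Q : ℕ := 2 ^ (k + 1) with hQ
    have hQpos : (0 : ℝ) < Q := by positivity
    have hQ2 : (Q : ℝ) = 2 * 2 ^ k := by rw [hQ]; push_cast; ring
    -- `Q ≤ 2 D²`, so `1 + log Q ≤ 2 (1 + log D)`
    have hQle : (Q : ℝ) ≤ 2 * ((D : ℝ) * D) := by
      have h1 : 2 ^ k ≤ D * D := (Nat.pow_le_pow_right two_pos hk').trans
        (Nat.pow_log_le_self 2 (by positivity))
      rw [hQ2]; exact_mod_cast Nat.mul_le_mul_left 2 h1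
    have hlogQ : 1 + Real.log Q ≤ 2 * (1 + Real.log D) := by
      have h1 : Real.log Q ≤ Real.log (2 * ((D : ℝ) * D)) := Real.log_le_log hQpos hQle
      rw [Real.log_mul (by norm_num) (by positivity), Real.log_mul hD0.ne' hD0.ne'] at h1
      linarith [Real.log_two_lt_d9]
    have hlogQ0 : 0 ≤ 1 + Real.log Q := by
      have : (1 : ℝ) ≤ Q := by exact_mod_cast Nat.one_le_two_pow
      linarith [Real.log_nonneg this]
    -- the min
    have hmin : min ((σ 0 f : ℝ) ^ 2 * (Q : ℝ) ^ 2) ((Q : ℝ) * R + (R : ℝ) ^ 3) / 2 ^ k ≤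
        4 * (σ 0 f : ℝ) ^ 2 * ((R : ℝ) * Real.sqrt R) := by
      have h2k : (2 : ℝ) ^ k = Q / 2 := by rw [hQ2]; ring
      rw [h2k, div_div_eq_mul_div]
      have hm : min ((σ 0 f : ℝ) ^ 2 * (Q : ℝ) ^ 2) ((Q : ℝ) * R + (R : ℝ) ^ 3) =
          Q * min ((σ 0 f : ℝ) ^ 2 * Q) (R + (R : ℝ) ^ 3 / Q) := by
        rw [mul_min_of_nonneg _ _ hQpos.le]
        congr 1
        · ring
        · field_simp
      rw [hm, mul_comm (Q : ℝ), mul_assoc, mul_div_assoc, mul_div_cancel_left₀ _ hQpos.ne']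
      have := min_linear_hyperbolic_le (a := (σ 0 f : ℝ) ^ 2) (one_le_pow₀ hσf) hQpos hR1
      linarith
    simp only [hB]
    rw [mul_assoc C, mul_div_assoc, mul_comm (min _ _), mul_div_assoc]
    calc C * (((1 + Real.log Q) * (1 + Real.log R)) ^ κ *
          (min ((σ 0 f : ℝ) ^ 2 * (Q : ℝ) ^ 2) ((Q : ℝ) * R + (R : ℝ) ^ 3) / 2 ^ k))
        ≤ C * (((2 * (1 + Real.log D)) * (1 + Real.log R)) ^ κ *
          (4 * (σ 0 f : ℝ) ^ 2 * ((R : ℝ) * Real.sqrt R))) := by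
          refine mul_le_mul_of_nonneg_left (mul_le_mul ?_ hmin ?_ (by positivity)) hC.le
          · exact pow_le_pow_left₀ (by positivity) (by gcongr) κ
          · positivity
      _ = 4 * C * (σ 0 f : ℝ) ^ 2 * ((R : ℝ) * Real.sqrt R) *
          ((2 * (1 + Real.log D)) * (1 + Real.log R)) ^ κ := by ring
  have step2 : ∑ q ∈ Icc 1 (D * D), h q / q ≤
      (Nat.log 2 (D * D) + 1 : ℕ) * (4 * C * (σ 0 f : ℝ) ^ 2 * ((R : ℝ) * Real.sqrt R) *
        ((2 * (1 + Real.log D)) * (1 + Real.log R)) ^ κ) := by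
    refine (sum_div_le_sum_dyadic hh0 hBQ (D * D)).trans ?_
    refine (sum_le_sum hblock).trans ?_
    rw [sum_const, card_range, nsmul_eq_mul]
  -- step 3: count the blocks and assemble
  have hcount : ((Nat.log 2 (D * D) + 1 : ℕ) : ℝ) ≤ 4 * (1 + Real.log D) := by
    have h1 := natLog_two_add_one_le (Q := D * D) (by positivity)
    push_cast at h1 ⊢
    rw [Real.log_mul hD0.ne' hD0.ne'] at h1
    linarith
  have hsum : ∑ p ∈ (Icc 1 D) ×ˢ (Icc 1 D), h (p.1 * p.2) / ((p.1 * p.2 : ℕ) : ℝ) ≤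
      16 * 2 ^ κ * C * Cd * (σ 0 f : ℝ) ^ 2 * ((R : ℝ) * Real.sqrt R) * (D : ℝ) ^ ε *
        (1 + Real.log D) ^ (κ + 1) * (1 + Real.log R) ^ (κ + 1) := by
    refine step1.trans ?_
    have hpos : 0 ≤ 4 * C * (σ 0 f : ℝ) ^ 2 * ((R : ℝ) * Real.sqrt R) *
        ((2 * (1 + Real.log D)) * (1 + Real.log R)) ^ κ := by positivity
    calc Cd * (D : ℝ) ^ ε * ∑ q ∈ Icc 1 (D * D), h q / q
        ≤ Cd * (D : ℝ) ^ ε * ((4 * (1 + Real.log D)) * (4 * C * (σ 0 f : ℝ) ^ 2 * ((R : ℝ) * Real.sqrt R) *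
            ((2 * (1 + Real.log D)) * (1 + Real.log R)) ^ κ)) := by
          refine mul_le_mul_of_nonneg_left (step2.trans ?_) (by positivity)
          exact mul_le_mul_of_nonneg_right hcount hpos
      _ = 16 * 2 ^ κ * C * Cd * (σ 0 f : ℝ) ^ 2 * ((R : ℝ) * Real.sqrt R) * (D : ℝ) ^ ε *
            (1 + Real.log D) ^ (κ + 1) * (1 + Real.log R) ^ κ := by rw [mul_pow, mul_pow]; ring
      _ ≤ 16 * 2 ^ κ * C * Cd * (σ 0 f : ℝ) ^ 2 * ((R : ℝ) * Real.sqrt R) * (D : ℝ) ^ ε *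
            (1 + Real.log D) ^ (κ + 1) * (1 + Real.log R) ^ (κ + 1) := by
          refine mul_le_mul_of_nonneg_left ?_ (by positivity)
          exact pow_le_pow_right₀ (by linarith) (Nat.le_succ κ)
  -- the statement's summand is `h (p.1 p.2) / (p.1 p.2)`
  refine le_of_eq_of_le (sum_congr rfl fun p _ => ?_) hsum
  simp only [hh, hS]


/-! ### Lemma 11.4 -/

/-- The gcd decomposition of a pair: `d₁ = e b₁`, `d₂ = e b₂`, `d₁ d₂ = e² b₁ b₂`, `[d₁, d₂] = e b₁ b₂`
with `e = (d₁, d₂)`, `bᵢ = dᵢ/e`. [folklore] -/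
theorem gcd_decomposition {d₁ d₂ : ℕ} (h₁ : 0 < d₁) :
    d₁ = Nat.gcd d₁ d₂ * (d₁ / Nat.gcd d₁ d₂) ∧ d₂ = Nat.gcd d₁ d₂ * (d₂ / Nat.gcd d₁ d₂) ∧
    d₁ * d₂ = Nat.gcd d₁ d₂ ^ 2 * (d₁ / Nat.gcd d₁ d₂ * (d₂ / Nat.gcd d₁ d₂)) ∧
    Nat.lcm d₁ d₂ = Nat.gcd d₁ d₂ * (d₁ / Nat.gcd d₁ d₂ * (d₂ / Nat.gcd d₁ d₂)) := by
  set e := Nat.gcd d₁ d₂ with he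
  have he0 : 0 < e := Nat.gcd_pos_of_pos_left _ h₁
  have hd₁ : d₁ = e * (d₁ / e) := (Nat.mul_div_cancel' (Nat.gcd_dvd_left d₁ d₂)).symm
  have hd₂ : d₂ = e * (d₂ / e) := (Nat.mul_div_cancel' (Nat.gcd_dvd_right d₁ d₂)).symm
  have hprod : d₁ * d₂ = e ^ 2 * (d₁ / e * (d₂ / e)) := by
    conv_lhs => rw [hd₁, hd₂]
    ring
  refine ⟨hd₁, hd₂, hprod, ?_⟩
  have h := Nat.gcd_mul_lcm d₁ d₂
  rw [← he, hprod, sq, mul_assoc] at h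
  exact Nat.eq_of_mul_eq_mul_left he0 h

/-- **FI Lemma 11.4.** For every `ε > 0` there is `C = C(ε)` with
`∑_{d₁, d₂ ≤ D, d₁'d₂' ≠ □} [d₁, d₂]⁻¹ |∑_{r ≤ R, (r, d₁d₂) = 1} (r / d₁'d₂')|² ≤ C R^{3/2} (DR)^ε`
for all `D, R` (`d'` the odd part, `(· / ·)` the Jacobi symbol). Proof as printed: pull out
`e = (d₁, d₂)`, `dᵢ = e bᵢ`, so `[d₁, d₂] = e b₁ b₂`, `(d₁d₂)' = e'² (b₁b₂)'` and the summand becomes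
`|∑_{r ≤ R, (r, ẽ) = 1} (r / (b₁b₂)')|² / (e b₁ b₂)` with `ẽ ∈ {e, 2e}` (`ite_coprime_jacobiSym_sq_mul`);
extend to all `b₁, b₂ ≤ D` by positivity and apply the weighted form of Lemma 11.3
(`sum_pairs_weighted_sq_le`) for `ẽ = e` and `ẽ = 2e`; finally `∑_{e ≤ D} τ(e)²/e ≪ (log D)^{O(1)}`
and powers of `log D`, `log R` are absorbed into `(DR)^ε`.
[cite: FriedlanderIwaniecAnnals1998, Lemma 11.4, (11.17)] -/
theorem sum_sq_coprime_jacobiSym_div_lcm_le {ε : ℝ} (hε : 0 < ε) :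
    ∃ C : ℝ, 0 < C ∧ ∀ D R : ℕ,
      ∑ p ∈ ((Icc 1 D) ×ˢ (Icc 1 D)).filter (fun p : ℕ × ℕ => ¬IsSquare (ordCompl[2] (p.1 * p.2))),
        ((∑ r ∈ (Icc 1 R).filter (fun r => r.Coprime (p.1 * p.2)),
            J(r | ordCompl[2] (p.1 * p.2)) : ℤ) : ℝ) ^ 2 / (Nat.lcm p.1 p.2 : ℝ) ≤
      C * (R : ℝ) ^ (3 / 2 : ℝ) * ((D : ℝ) * R) ^ ε := by
  obtain ⟨C₁, hC₁, κ₁, hW⟩ := sum_pairs_weighted_sq_le (half_pos hε)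
  obtain ⟨C₂, hC₂, κ₂, hτ⟩ := exists_sum_tau_pow_div_le_one 2
  obtain ⟨C₃, hC₃, hL3⟩ := exists_one_add_log_pow_le_rpow (κ₁ + κ₂) (half_pos hε)
  obtain ⟨C₄, hC₄, hL4⟩ := exists_one_add_log_pow_le_rpow κ₁ hε
  refine ⟨5 * C₁ * C₂ * C₃ * C₄, by positivity, fun D R => ?_⟩
  -- notation
  set S : ℕ → ℕ → ℝ := fun f n =>
    ((∑ r ∈ (Icc 1 R).filter (fun r => r.Coprime f), J(r | n) : ℤ) : ℝ) with hS
  set pairs := (Icc 1 D) ×ˢ (Icc 1 D) with hpairs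
  set W : ℕ → ℝ := fun f => ∑ p ∈ pairs,
    (if ¬IsSquare (ordCompl[2] (p.1 * p.2)) then S f (ordCompl[2] (p.1 * p.2)) ^ 2 else 0) /
      ((p.1 * p.2 : ℕ) : ℝ) with hWdef
  -- degenerate cases
  have hRHS : 0 ≤ 5 * C₁ * C₂ * C₃ * C₄ * (R : ℝ) ^ (3 / 2 : ℝ) * ((D : ℝ) * R) ^ ε := by positivity
  rcases Nat.eq_zero_or_pos D with rfl | hD
  · simp only [hpairs, zero_lt_one, Icc_eq_empty_of_lt, empty_product, filter_empty, sum_empty]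
    positivity
  rcases Nat.eq_zero_or_pos R with rfl | hR
  · refine le_trans (le_of_eq (sum_eq_zero fun p _ => ?_)) hRHS
    simp
  have hD1 : (1 : ℝ) ≤ D := by exact_mod_cast hD
  have hR1 : (1 : ℝ) ≤ R := by exact_mod_cast hR
  have hD0 : (0 : ℝ) < D := by linarith
  have hR0 : (0 : ℝ) < R := by linarith
  -- Step A: pull out the gcd
  set G : ℕ × (ℕ × ℕ) → ℝ := fun x =>
    ((if ¬IsSquare (ordCompl[2] (x.2.1 * x.2.2)) then S x.1 (ordCompl[2] (x.2.1 * x.2.2)) ^ 2 else 0) /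
        ((x.2.1 * x.2.2 : ℕ) : ℝ) +
      (if ¬IsSquare (ordCompl[2] (x.2.1 * x.2.2)) then S (2 * x.1) (ordCompl[2] (x.2.1 * x.2.2)) ^ 2
        else 0) / ((x.2.1 * x.2.2 : ℕ) : ℝ)) / (x.1 : ℝ) with hGdef
  have hG0 : ∀ x, 0 ≤ G x := fun x => by
    simp only [hGdef]
    refine div_nonneg (add_nonneg ?_ ?_) (Nat.cast_nonneg _) <;>
    · refine div_nonneg ?_ (Nat.cast_nonneg _); split_ifs <;> positivity
  set gmap : ℕ × ℕ → ℕ × (ℕ × ℕ) := fun P =>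
    (Nat.gcd P.1 P.2, (P.1 / Nat.gcd P.1 P.2, P.2 / Nat.gcd P.1 P.2)) with hgmap
  have hterm : ∀ P ∈ pairs.filter (fun p : ℕ × ℕ => ¬IsSquare (ordCompl[2] (p.1 * p.2))),
      S (P.1 * P.2) (ordCompl[2] (P.1 * P.2)) ^ 2 / (Nat.lcm P.1 P.2 : ℝ) ≤ G (gmap P) := by
    intro P hP
    rw [mem_filter, hpairs, mem_product, mem_Icc, mem_Icc] at hP
    obtain ⟨⟨⟨h1, -⟩, h2, -⟩, hnsq⟩ := hP
    obtain ⟨hd₁, hd₂, hprod, hlcm⟩ := gcd_decomposition (d₂ := P.2) h1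
    set e := Nat.gcd P.1 P.2 with he
    set m := P.1 / e * (P.2 / e) with hm
    have he0 : 0 < e := Nat.gcd_pos_of_pos_left _ h1
    have hb₁ : 0 < P.1 / e := Nat.div_pos (Nat.gcd_le_left _ h1) he0
    have hb₂ : 0 < P.2 / e := Nat.div_pos (Nat.gcd_le_right _ h2) he0
    have hm0 : 0 < m := Nat.mul_pos hb₁ hb₂
    rw [hprod] at hnsq
    have hnsq' : ¬IsSquare (ordCompl[2] m) := not_isSquare_ordCompl_of_sq_mul hnsq
    -- the character sum at `P` is `S ẽ m'`
    have hT : S (P.1 * P.2) (ordCompl[2] (P.1 * P.2)) =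
        S (if Even m then 2 * e else e) (ordCompl[2] m) := by
      simp only [hS, hprod]
      congr 1
      rw [sum_filter, sum_filter]
      exact sum_congr rfl fun r _ => ite_coprime_jacobiSym_sq_mul he0 hm0 r
    have hsq : S (P.1 * P.2) (ordCompl[2] (P.1 * P.2)) ^ 2 ≤
        S e (ordCompl[2] m) ^ 2 + S (2 * e) (ordCompl[2] m) ^ 2 := by
      rw [hT]
      split_ifs
      · linarith [sq_nonneg (S e (ordCompl[2] m))]
      · linarith [sq_nonneg (S (2 * e) (ordCompl[2] m))]
    have hGval : ∀ a b₁ b₂ : ℕ, G (a, (b₁, b₂)) =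
        ((if ¬IsSquare (ordCompl[2] (b₁ * b₂)) then S a (ordCompl[2] (b₁ * b₂)) ^ 2 else 0) /
            ((b₁ * b₂ : ℕ) : ℝ) +
          (if ¬IsSquare (ordCompl[2] (b₁ * b₂)) then S (2 * a) (ordCompl[2] (b₁ * b₂)) ^ 2 else 0) /
            ((b₁ * b₂ : ℕ) : ℝ)) / (a : ℝ) := fun _ _ _ => rfl
    have hG : G (gmap P) = (S e (ordCompl[2] m) ^ 2 + S (2 * e) (ordCompl[2] m) ^ 2) /
        ((e * m : ℕ) : ℝ) := by
      have h1 : gmap P = (e, (P.1 / e, P.2 / e)) := rfl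
      rw [h1, hGval, ← hm, if_pos hnsq', if_pos hnsq', ← add_div, div_div, Nat.cast_mul e m,
        mul_comm (m : ℝ)]
    rw [hG, hlcm]
    exact div_le_div_of_nonneg_right hsq (Nat.cast_nonneg _)
  have hmaps : ∀ P ∈ pairs.filter (fun p : ℕ × ℕ => ¬IsSquare (ordCompl[2] (p.1 * p.2))),
      gmap P ∈ (Icc 1 D) ×ˢ pairs := by
    intro P hP
    rw [mem_filter, hpairs, mem_product, mem_Icc, mem_Icc] at hP
    obtain ⟨⟨⟨h1, h1D⟩, h2, h2D⟩, -⟩ := hP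
    have he0 : 0 < Nat.gcd P.1 P.2 := Nat.gcd_pos_of_pos_left _ h1
    simp only [hgmap, hpairs, mem_product, mem_Icc]
    exact ⟨⟨he0, (Nat.gcd_le_left _ h1).trans h1D⟩,
      ⟨Nat.div_pos (Nat.gcd_le_left _ h1) he0, (Nat.div_le_self _ _).trans h1D⟩,
      ⟨Nat.div_pos (Nat.gcd_le_right _ h2) he0, (Nat.div_le_self _ _).trans h2D⟩⟩
  have hinj : Set.InjOn gmap ↑(pairs.filter (fun p : ℕ × ℕ => ¬IsSquare (ordCompl[2] (p.1 * p.2)))) := by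
    intro P hP P' hP' h
    rw [mem_coe, mem_filter, hpairs, mem_product, mem_Icc, mem_Icc] at hP hP'
    simp only [hgmap, Prod.mk.injEq] at h
    obtain ⟨hg, hq1, hq2⟩ := h
    have e1 := (gcd_decomposition (d₂ := P.2) hP.1.1.1).1
    have e2 := (gcd_decomposition (d₂ := P.2) hP.1.1.1).2.1
    have e1' := (gcd_decomposition (d₂ := P'.2) hP'.1.1.1).1
    have e2' := (gcd_decomposition (d₂ := P'.2) hP'.1.1.1).2.1
    refine Prod.ext ?_ ?_
    · rw [e1, e1', hq1, hg]
    · rw [e2, e2', hq2, hg]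
  have stepA : ∑ p ∈ pairs.filter (fun p : ℕ × ℕ => ¬IsSquare (ordCompl[2] (p.1 * p.2))),
      S (p.1 * p.2) (ordCompl[2] (p.1 * p.2)) ^ 2 / (Nat.lcm p.1 p.2 : ℝ) ≤
        ∑ x ∈ (Icc 1 D) ×ˢ pairs, G x := by
    calc ∑ p ∈ pairs.filter (fun p : ℕ × ℕ => ¬IsSquare (ordCompl[2] (p.1 * p.2))),
          S (p.1 * p.2) (ordCompl[2] (p.1 * p.2)) ^ 2 / (Nat.lcm p.1 p.2 : ℝ)
        ≤ ∑ p ∈ pairs.filter (fun p : ℕ × ℕ => ¬IsSquare (ordCompl[2] (p.1 * p.2))), G (gmap p) :=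
          sum_le_sum hterm
      _ = ∑ x ∈ (pairs.filter (fun p : ℕ × ℕ => ¬IsSquare (ordCompl[2] (p.1 * p.2)))).image gmap, G x := by
          rw [sum_image hinj]
      _ ≤ ∑ x ∈ (Icc 1 D) ×ˢ pairs, G x :=
          sum_le_sum_of_subset_of_nonneg (image_subset_iff.mpr hmaps) fun _ _ _ => hG0 _
  -- Step B: the double sum is `∑_e (W e + W (2e)) / e`
  have stepB : ∑ x ∈ (Icc 1 D) ×ˢ pairs, G x = ∑ e ∈ Icc 1 D, (W e + W (2 * e)) / e := by
    rw [sum_product]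
    refine sum_congr rfl fun e _ => ?_
    simp only [hGdef, hWdef]
    rw [← sum_div, sum_add_distrib]
  -- Step C: the bound for each `e`
  set K : ℝ := ((R : ℝ) * Real.sqrt R) * (D : ℝ) ^ (ε / 2) * (1 + Real.log D) ^ κ₁ *
    (1 + Real.log R) ^ κ₁ with hK
  have hK0 : 0 ≤ K := by positivity
  have hWle : ∀ f, 0 < f → W f ≤ C₁ * (σ 0 f : ℝ) ^ 2 * K := by
    intro f hf
    have := hW f D R hf hD hR
    simp only [hWdef, hS, hK]
    calc _ ≤ C₁ * (σ 0 f : ℝ) ^ 2 * ((R : ℝ) * Real.sqrt R) * (D : ℝ) ^ (ε / 2) *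
          (1 + Real.log D) ^ κ₁ * (1 + Real.log R) ^ κ₁ := this
      _ = _ := by ring
  have stepC : ∀ e ∈ Icc 1 D, (W e + W (2 * e)) / e ≤ 5 * C₁ * K * ((σ 0 e : ℝ) ^ 2 / e) := by
    intro e he
    rw [mem_Icc] at he
    have he0 : 0 < e := he.1
    have hσ2 : (σ 0 (2 * e) : ℝ) ≤ 2 * σ 0 e := by
      have := sigma_zero_mul_le 2 e
      have h2 : σ 0 2 = 2 := by rw [ArithmeticFunction.sigma_zero_apply]; decide
      rw [h2] at this
      exact_mod_cast this
    have h1 := hWle e he0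
    have h2 := hWle (2 * e) (by omega)
    have h3 : W e + W (2 * e) ≤ 5 * C₁ * K * (σ 0 e : ℝ) ^ 2 := by
      have : (σ 0 (2 * e) : ℝ) ^ 2 ≤ 4 * (σ 0 e : ℝ) ^ 2 := by
        nlinarith [hσ2, (Nat.cast_nonneg (σ 0 (2 * e)) : (0 : ℝ) ≤ σ 0 (2 * e))]
      nlinarith [mul_nonneg hC₁.le hK0]
    rw [mul_div_assoc']
    exact div_le_div_of_nonneg_right h3 (Nat.cast_nonneg e)
  -- Step D: sum over `e` and absorb the logarithms
  have hsumτ : ∑ e ∈ Icc 1 D, (σ 0 e : ℝ) ^ 2 / e ≤ C₂ * (1 + Real.log D) ^ κ₂ := by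
    have := hτ D hD1
    rwa [Nat.floor_natCast] at this
  have hmain : ∑ p ∈ pairs.filter (fun p : ℕ × ℕ => ¬IsSquare (ordCompl[2] (p.1 * p.2))),
      S (p.1 * p.2) (ordCompl[2] (p.1 * p.2)) ^ 2 / (Nat.lcm p.1 p.2 : ℝ) ≤
        5 * C₁ * C₂ * K * (1 + Real.log D) ^ κ₂ := by
    refine stepA.trans ?_
    rw [stepB]
    refine (sum_le_sum stepC).trans ?_
    rw [← mul_sum]
    calc 5 * C₁ * K * ∑ e ∈ Icc 1 D, (σ 0 e : ℝ) ^ 2 / e ≤ 5 * C₁ * K * (C₂ * (1 + Real.log D) ^ κ₂) :=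
          mul_le_mul_of_nonneg_left hsumτ (by positivity)
      _ = 5 * C₁ * C₂ * K * (1 + Real.log D) ^ κ₂ := by ring
  have hlogs : K * (1 + Real.log D) ^ κ₂ ≤ C₃ * C₄ * (R : ℝ) ^ (3 / 2 : ℝ) * ((D : ℝ) * R) ^ ε := by
    have h3 := hL3 D hD1
    have h4 := hL4 R hR1
    have hRs : (R : ℝ) * Real.sqrt R = (R : ℝ) ^ (3 / 2 : ℝ) := by
      rw [Real.sqrt_eq_rpow, ← Real.rpow_one_add' hR0.le (by norm_num)]
      norm_num
    have hDD : (D : ℝ) ^ (ε / 2) * (D : ℝ) ^ (ε / 2) = (D : ℝ) ^ ε := by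
      rw [← Real.rpow_add hD0]; ring_nf
    have hDR : (D : ℝ) ^ ε * (R : ℝ) ^ ε = ((D : ℝ) * R) ^ ε :=
      (Real.mul_rpow hD0.le hR0.le).symm
    calc K * (1 + Real.log D) ^ κ₂
        = ((R : ℝ) * Real.sqrt R) * (D : ℝ) ^ (ε / 2) *
            ((1 + Real.log D) ^ (κ₁ + κ₂) * (1 + Real.log R) ^ κ₁) := by rw [hK, pow_add]; ring
      _ ≤ ((R : ℝ) * Real.sqrt R) * (D : ℝ) ^ (ε / 2) *
            ((C₃ * (D : ℝ) ^ (ε / 2)) * (C₄ * (R : ℝ) ^ ε)) := by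
          refine mul_le_mul_of_nonneg_left (mul_le_mul h3 h4 (by positivity) (by positivity))
            (by positivity)
      _ = C₃ * C₄ * ((R : ℝ) * Real.sqrt R) * ((D : ℝ) ^ (ε / 2) * (D : ℝ) ^ (ε / 2)) * (R : ℝ) ^ ε := by
          ring
      _ = C₃ * C₄ * (R : ℝ) ^ (3 / 2 : ℝ) * ((D : ℝ) * R) ^ ε := by
          rw [hDD, hRs, mul_assoc, hDR]
  calc ∑ p ∈ pairs.filter (fun p : ℕ × ℕ => ¬IsSquare (ordCompl[2] (p.1 * p.2))),
        S (p.1 * p.2) (ordCompl[2] (p.1 * p.2)) ^ 2 / (Nat.lcm p.1 p.2 : ℝ)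
      ≤ 5 * C₁ * C₂ * (K * (1 + Real.log D) ^ κ₂) := by rw [← mul_assoc]; exact hmain
    _ ≤ 5 * C₁ * C₂ * (C₃ * C₄ * (R : ℝ) ^ (3 / 2 : ℝ) * ((D : ℝ) * R) ^ ε) :=
        mul_le_mul_of_nonneg_left hlogs (by positivity)
    _ = 5 * C₁ * C₂ * C₃ * C₄ * (R : ℝ) ^ (3 / 2 : ℝ) * ((D : ℝ) * R) ^ ε := by ring


end Literature.NumberTheory.Sieve.FriedlanderIwaniecPrimes
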